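import Summits.PneNP.PneNP.Theorems.ChebyshevTracialDesignClosedPairCount
import HarnessLib

/-!
# Cell pnp-psdrank, route `ChebyshevTracialDesign`: BOTH TAILS OF THE CROSSING-COUNT LAW OF A UNIFORM PERFECT MATCHING, part A —
# ratio of consecutive classes, one-step and iterated comparisons, the two tails under one-line arithmetic hypotheses
# (crux `TracialDecayExp20`, stmt-PneNP-19878)

Engine brick (eng g20), part A of two. For a vertex set `S`, a block `U ⊆ S` with `|U| = h`, `|S ∖ U| = h'`, and a perfect matching `M`
of `S`, write `cr(U,M) = #{e ∈ M | cutCount U e = 1}` for the number of edges of `M` CROSSING `U` (the MIXED edges of the `(U,M)`-type;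
Rothvoß's `|δ(U) ∩ M|` [cite: Rothvoss2017, §2 (PDF p. 5)]) and `N(b) = #{M ∈ PM(S) | cr(U,M) = b}`. The tree's partner-recursion count
`card_pm_filter_cr_mul` (`N(b)·b!·2^i i!·2^{i'} i'! = h!·h'!` for `h = b + 2i`, `h' = b + 2i'`) gives the RATIO OF CONSECUTIVE CLASSES
* §1 **`card_cr_mul_eq`** / **`card_cr_mul_sub_eq`** — `N(b)·(h − b)(h' − b) = N(b+2)·(b+1)(b+2)` (exact, in `ℕ`);
hence one-step comparisons under one-line arithmetic hypotheses
* §2 **`card_cr_le_mul_of_le`** — `(b+1)(b+2) ≤ ρ·(h−b)(h'−b) ⟹ N(b) ≤ ρ·N(b+2)` (no side conditions: the degenerate classes are empty),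
  **`card_cr_add_two_le_mul_of_le`** — `(h−b)(h'−b) ≤ ρ·(b+1)(b+2) ⟹ N(b+2) ≤ ρ·N(b)` (`0 ≤ ρ`);
* §3 their iterates **`card_cr_le_pow_mul`** (`N(b) ≤ ρ^m N(b+2m)`), **`card_cr_add_le_pow_mul`** (`N(b+2m) ≤ ρ^m N(b)`);
* §4 **`card_filter_cr_le_le`** — LOWER TAIL: if `(b+1)(b+2) ≤ ρ(h−b)(h'−b)` for all `b < a₀ + 2m` then
  `#{M : cr(U,M) ≤ a₀} ≤ (a₀+1)·ρ^m·#PM(S)`; **`card_filter_le_cr_le`** — UPPER TAIL: if `(h−b)(h'−b) ≤ ρ(b+1)(b+2)` for all `b ≥ L`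
  (with `b + 2 ≤ h, h'`) then `#{M : L + 2m ≤ cr(U,M)} ≤ (h+1)·ρ^m·#PM(S)`.
Part B (`…CrossingCountTailsExplicit`) instantiates `ρ = 1/4`: `#{cr ≤ a₀} ≤ 2^{−a₀}·#PM` for `9a₀+1 ≤ min(h,h')`, the balanced upper
tail, and the `PMatch n` forms. USE (LIT-44 §3(b)/§5 (e4), LIT-45 §2, prover MEMO-23 §7): in the per-matching pricing of `H`-symmetric
masks `g(|U ∩ H|)` the x-smoothness of the shell laws comes from a conditional hypergeometric component whose variance is `≍ b_M(H) = cr(H,M)`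
(and, for `|H| = n/2`, also needs non-crossing edges on both sides); the matchings with `b_M(H) < βN` (or `> (1−β)N`) are the ALIGNED
exceptional set, to be charged to the `M`-average — these two files bound its mass by `2^{−Ω(N)}` with explicit constants (eng MEMO-19 (eng)
tabulates the exact masses and the x-smoothness per type at the crux's scales). [cite: Rothvoss2017, §2 (PDF p. 5)] [folklore]
Stature: support/instrument (kernel lane: no definitions, axioms standard). WHAT THIS IS NOT: nothing on the design value, no proof or
refutation of `TracialDecayExp20`, nothing on the psd rank of `P_PM(K_n)`, no P-vs-NP content. Supports stmt-PneNP-19878.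
-/

set_option linter.dupNamespace false -- `Summit.PneNP.PneNP.…`: summit = sub-problem (D-0017)

namespace Summit.PneNP.PneNP.Theorems.ChebyshevTracialDesignCrossingCountTails

open Finset Literature.Barriers.PneNP Literature.Combinatorics.SimpleGraph.CycleSpace
open Summit.PneNP.PneNP.Theorems.ChebyshevTracialDesignJunta
open Summit.PneNP.PneNP.Theorems.ChebyshevTracialDesignClosedPairCount (card_filter_pmatch)

section General

variable {V : Type*} [DecidableEq V]

/-! ### §1 The ratio of consecutive crossing-count classes -/

/-- **Ratio of consecutive classes (parametrised form).** For `U ⊆ S` with `|U| = a + 2(j+1)` and `|S ∖ U| = a + 2(j'+1)`: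
`N(a)·(2(j+1))·(2(j'+1)) = N(a+2)·(a+1)(a+2)`, where `N(b) = #{M ∈ PM(S) | cr(U,M) = b}`. From the tree's
`card_pm_filter_cr_mul` at `a` and at `a + 2` by cancelling `a!·2^j j!·2^{j'} j'!`. [cite: Rothvoss2017, §2 (PDF p. 5)] [folklore] -/
theorem card_cr_mul_eq {S U : Finset V} (hU : U ⊆ S) {a j j' : ℕ}
    (hUc : U.card = a + 2 * (j + 1)) (hSc : (S \ U).card = a + 2 * (j' + 1)) :
    ((perfectMatchings S).filter fun M => (M.filter fun e => cutCount U e = 1).card = a).card *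
        (2 * (j + 1) * (2 * (j' + 1))) =
      ((perfectMatchings S).filter fun M => (M.filter fun e => cutCount U e = 1).card = a + 2).card *
        ((a + 1) * (a + 2)) := by
  have h1 := card_pm_filter_cr_mul hU (a := a) (i := j + 1) (i' := j' + 1) hUc hSc
  have hUc' : U.card = (a + 2) + 2 * j := by omega
  have hSc' : (S \ U).card = (a + 2) + 2 * j' := by omega
  have h2 := card_pm_filter_cr_mul hU (a := a + 2) (i := j) (i' := j') hUc' hSc'
  set N1 := ((perfectMatchings S).filter fun M => (M.filter fun e => cutCount U e = 1).card = a).card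
  set N2 := ((perfectMatchings S).filter fun M => (M.filter fun e => cutCount U e = 1).card = a + 2).card
  have hK : 0 < a.factorial * (2 ^ j * j.factorial) * (2 ^ j' * j'.factorial) := by positivity
  apply Nat.eq_of_mul_eq_mul_right hK
  have e1 : (a + 2 * (j + 1)).factorial * (a + 2 * (j' + 1)).factorial =
      (a + 2 + 2 * j).factorial * (a + 2 + 2 * j').factorial := by
    congr 2 <;> ring
  have f1 : 2 ^ (j + 1) * (j + 1).factorial = 2 * (j + 1) * (2 ^ j * j.factorial) := by
    rw [pow_succ, Nat.factorial_succ]; ring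
  have f2 : 2 ^ (j' + 1) * (j' + 1).factorial = 2 * (j' + 1) * (2 ^ j' * j'.factorial) := by
    rw [pow_succ, Nat.factorial_succ]; ring
  have f3 : (a + 2).factorial = (a + 1) * (a + 2) * a.factorial := by
    rw [show a + 2 = (a + 1) + 1 from rfl, Nat.factorial_succ, Nat.factorial_succ]; ring
  rw [f1, f2] at h1
  rw [f3] at h2
  calc N1 * (2 * (j + 1) * (2 * (j' + 1))) * (a.factorial * (2 ^ j * j.factorial) * (2 ^ j' * j'.factorial))
      = N1 * (a.factorial * (2 * (j + 1) * (2 ^ j * j.factorial)) *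
          (2 * (j' + 1) * (2 ^ j' * j'.factorial))) := by ring
    _ = (a + 2 * (j + 1)).factorial * (a + 2 * (j' + 1)).factorial := h1
    _ = (a + 2 + 2 * j).factorial * (a + 2 + 2 * j').factorial := e1
    _ = N2 * ((a + 1) * (a + 2) * a.factorial * (2 ^ j * j.factorial) * (2 ^ j' * j'.factorial)) := h2.symm
    _ = N2 * ((a + 1) * (a + 2)) * (a.factorial * (2 ^ j * j.factorial) * (2 ^ j' * j'.factorial)) := by ring

/-- **Ratio of consecutive classes**: `N(a)·(|U| − a)·(|S ∖ U| − a) = N(a+2)·(a+1)(a+2)` whenever `a + 2 ≤ |U|`, `a + 2 ≤ |S ∖ U|`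
and both differences are even (the other classes are empty, `pm_filter_cr_eq_empty`). [cite: Rothvoss2017, §2 (PDF p. 5)] [folklore] -/
theorem card_cr_mul_sub_eq {S U : Finset V} (hU : U ⊆ S) {a : ℕ} (ha : a + 2 ≤ U.card)
    (ha' : a + 2 ≤ (S \ U).card) (he : Even (U.card - a)) (he' : Even ((S \ U).card - a)) :
    ((perfectMatchings S).filter fun M => (M.filter fun e => cutCount U e = 1).card = a).card *
        ((U.card - a) * ((S \ U).card - a)) =
      ((perfectMatchings S).filter fun M => (M.filter fun e => cutCount U e = 1).card = a + 2).card *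
        ((a + 1) * (a + 2)) := by
  obtain ⟨r, hr⟩ := he
  obtain ⟨r', hr'⟩ := he'
  obtain ⟨j, rfl⟩ : ∃ j, r = j + 1 := ⟨r - 1, by omega⟩
  obtain ⟨j', rfl⟩ : ∃ j', r' = j' + 1 := ⟨r' - 1, by omega⟩
  have hUc : U.card = a + 2 * (j + 1) := by omega
  have hSc : (S \ U).card = a + 2 * (j' + 1) := by omega
  rw [show U.card - a = 2 * (j + 1) by omega, show (S \ U).card - a = 2 * (j' + 1) by omega]
  exact card_cr_mul_eq hU hUc hSc

/-! ### §2 One-step comparisons -/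

/-- Arithmetic of one comparison step: `N₁·D = N₂·E`, `E ≤ ρ·D`, `0 < D` give `N₁ ≤ ρ·N₂`. [folklore] -/
theorem cast_le_mul_of_mul_eq {N₁ N₂ : ℕ} {D E ρ : ℝ} (hD : 0 < D) (h : (N₁ : ℝ) * D = (N₂ : ℝ) * E)
    (hE : E ≤ ρ * D) : (N₁ : ℝ) ≤ ρ * (N₂ : ℝ) := by
  refine le_of_mul_le_mul_right ?_ hD
  calc (N₁ : ℝ) * D = (N₂ : ℝ) * E := h
    _ ≤ (N₂ : ℝ) * (ρ * D) := mul_le_mul_of_nonneg_left hE (Nat.cast_nonneg _)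
    _ = ρ * (N₂ : ℝ) * D := by ring

/-- The lower-tail hypothesis `(b+1)(b+2) ≤ ρ·(|U|−b)(|S∖U|−b)` forces `0 < ρ` and a positive right-hand product. [folklore] -/
theorem pos_of_lower_hyp {S U : Finset V} {ρ : ℝ} {b : ℕ}
    (hyp : ((b : ℝ) + 1) * ((b : ℝ) + 2) ≤ ρ * (((U.card - b : ℕ) : ℝ) * (((S \ U).card - b : ℕ) : ℝ))) :
    0 < ρ ∧ 0 < ((U.card - b : ℕ) : ℝ) * (((S \ U).card - b : ℕ) : ℝ) := by
  have hL : (0 : ℝ) < ((b : ℝ) + 1) * ((b : ℝ) + 2) := by positivity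
  have hD : (0 : ℝ) ≤ ((U.card - b : ℕ) : ℝ) * (((S \ U).card - b : ℕ) : ℝ) := by positivity
  have hρ : 0 < ρ := by
    by_contra h
    have h' : ρ ≤ 0 := not_lt.mp h
    have : ρ * (((U.card - b : ℕ) : ℝ) * (((S \ U).card - b : ℕ) : ℝ)) ≤ 0 :=
      mul_nonpos_of_nonpos_of_nonneg h' hD
    linarith
  refine ⟨hρ, ?_⟩
  rcases hD.lt_or_eq with h | h
  · exact h
  · rw [← h, mul_zero] at hyp
    linarith

/-- **Lower one-step comparison.** If `(b+1)(b+2) ≤ ρ·(|U| − b)(|S ∖ U| − b)` (natural-number differences), then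
`N(b) ≤ ρ·N(b+2)`. No side condition: if the class `b` is empty the claim is trivial, and the hypothesis itself excludes
`|U| = b` or `|S ∖ U| = b`. [cite: Rothvoss2017, §2 (PDF p. 5)] [folklore] -/
theorem card_cr_le_mul_of_le {S U : Finset V} (hU : U ⊆ S) {ρ : ℝ} {b : ℕ}
    (hyp : ((b : ℝ) + 1) * ((b : ℝ) + 2) ≤ ρ * (((U.card - b : ℕ) : ℝ) * (((S \ U).card - b : ℕ) : ℝ))) :
    ((((perfectMatchings S).filter fun M => (M.filter fun e => cutCount U e = 1).card = b).card : ℕ) : ℝ) ≤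
      ρ * ((((perfectMatchings S).filter fun M =>
        (M.filter fun e => cutCount U e = 1).card = b + 2).card : ℕ) : ℝ) := by
  obtain ⟨hρ, hD⟩ := pos_of_lower_hyp hyp
  by_cases hc : b ≤ U.card ∧ b ≤ (S \ U).card ∧ Even (U.card - b) ∧ Even ((S \ U).card - b)
  · obtain ⟨-, -, he, he'⟩ := hc
    have h1 : U.card - b ≠ 0 := by
      intro h0; rw [h0] at hD; simp at hD
    have h2 : (S \ U).card - b ≠ 0 := by
      intro h0; rw [h0] at hD; simp at hD
    have ha : b + 2 ≤ U.card := by obtain ⟨r, hr⟩ := he; omega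
    have ha' : b + 2 ≤ (S \ U).card := by obtain ⟨r, hr⟩ := he'; omega
    have key := card_cr_mul_sub_eq hU ha ha' he he'
    exact cast_le_mul_of_mul_eq hD (by exact_mod_cast key) hyp
  · rw [pm_filter_cr_eq_empty hU hc, card_empty, Nat.cast_zero]
    positivity

/-- **Upper one-step comparison.** If `0 ≤ ρ` and `(|U| − b)(|S ∖ U| − b) ≤ ρ·(b+1)(b+2)` whenever `b + 2 ≤ |U|` and
`b + 2 ≤ |S ∖ U|`, then `N(b+2) ≤ ρ·N(b)`. [cite: Rothvoss2017, §2 (PDF p. 5)] [folklore] -/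
theorem card_cr_add_two_le_mul_of_le {S U : Finset V} (hU : U ⊆ S) {ρ : ℝ} (hρ : 0 ≤ ρ) {b : ℕ}
    (hyp : b + 2 ≤ U.card → b + 2 ≤ (S \ U).card →
      ((U.card - b : ℕ) : ℝ) * (((S \ U).card - b : ℕ) : ℝ) ≤ ρ * (((b : ℝ) + 1) * ((b : ℝ) + 2))) :
    ((((perfectMatchings S).filter fun M => (M.filter fun e => cutCount U e = 1).card = b + 2).card : ℕ) : ℝ) ≤
      ρ * ((((perfectMatchings S).filter fun M =>
        (M.filter fun e => cutCount U e = 1).card = b).card : ℕ) : ℝ) := by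
  by_cases hc : b + 2 ≤ U.card ∧ b + 2 ≤ (S \ U).card ∧ Even (U.card - (b + 2)) ∧ Even ((S \ U).card - (b + 2))
  · obtain ⟨ha, ha', he, he'⟩ := hc
    have he2 : Even (U.card - b) := by
      obtain ⟨r, hr⟩ := he; exact ⟨r + 1, by omega⟩
    have he2' : Even ((S \ U).card - b) := by
      obtain ⟨r, hr⟩ := he'; exact ⟨r + 1, by omega⟩
    have key := card_cr_mul_sub_eq hU ha ha' he2 he2'
    have hE : (0 : ℝ) < ((b : ℝ) + 1) * ((b : ℝ) + 2) := by positivity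
    have keyR : ((((perfectMatchings S).filter fun M =>
          (M.filter fun e => cutCount U e = 1).card = b + 2).card : ℕ) : ℝ) * (((b : ℝ) + 1) * ((b : ℝ) + 2)) =
        ((((perfectMatchings S).filter fun M => (M.filter fun e => cutCount U e = 1).card = b).card : ℕ) : ℝ) *
          (((U.card - b : ℕ) : ℝ) * (((S \ U).card - b : ℕ) : ℝ)) := by
      exact_mod_cast key.symm
    exact cast_le_mul_of_mul_eq hE keyR (hyp ha ha')
  · rw [pm_filter_cr_eq_empty hU hc, card_empty, Nat.cast_zero]
    positivity

/-! ### §3 Iterated comparisons -/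

/-- **Iterated lower comparison**: under the lower hypothesis for all `b < L`, `N(b) ≤ ρ^m·N(b + 2m)` whenever
`b + 2m ≤ L + 1`. [folklore] -/
theorem card_cr_le_pow_mul {S U : Finset V} (hU : U ⊆ S) {ρ : ℝ} {L : ℕ}
    (hyp : ∀ b : ℕ, b < L →
      ((b : ℝ) + 1) * ((b : ℝ) + 2) ≤ ρ * (((U.card - b : ℕ) : ℝ) * (((S \ U).card - b : ℕ) : ℝ))) :
    ∀ m b : ℕ, b + 2 * m ≤ L + 1 →
      ((((perfectMatchings S).filter fun M => (M.filter fun e => cutCount U e = 1).card = b).card : ℕ) : ℝ) ≤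
        ρ ^ m * ((((perfectMatchings S).filter fun M =>
          (M.filter fun e => cutCount U e = 1).card = b + 2 * m).card : ℕ) : ℝ) := by
  intro m
  induction m with
  | zero => intro b _; simp
  | succ m ih =>
    intro b hb
    have hbL : b < L := by omega
    have hρ : 0 < ρ := (pos_of_lower_hyp (hyp b hbL)).1
    have step := card_cr_le_mul_of_le hU (hyp b hbL)
    have ih' := ih (b + 2) (by omega)
    rw [show b + 2 + 2 * m = b + 2 * (m + 1) by ring] at ih'
    calc _ ≤ ρ * _ := step
      _ ≤ ρ * (ρ ^ m * _) := mul_le_mul_of_nonneg_left ih' hρ.le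
      _ = ρ ^ (m + 1) * _ := by rw [pow_succ]; ring

/-- **Iterated upper comparison**: under the upper hypothesis for all `b ≥ L`, `N(b + 2m) ≤ ρ^m·N(b)` for every `b ≥ L`. [folklore] -/
theorem card_cr_add_le_pow_mul {S U : Finset V} (hU : U ⊆ S) {ρ : ℝ} (hρ : 0 ≤ ρ) {L : ℕ}
    (hyp : ∀ b : ℕ, L ≤ b → b + 2 ≤ U.card → b + 2 ≤ (S \ U).card →
      ((U.card - b : ℕ) : ℝ) * (((S \ U).card - b : ℕ) : ℝ) ≤ ρ * (((b : ℝ) + 1) * ((b : ℝ) + 2))) :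
    ∀ m b : ℕ, L ≤ b →
      ((((perfectMatchings S).filter fun M =>
          (M.filter fun e => cutCount U e = 1).card = b + 2 * m).card : ℕ) : ℝ) ≤
        ρ ^ m * ((((perfectMatchings S).filter fun M =>
          (M.filter fun e => cutCount U e = 1).card = b).card : ℕ) : ℝ) := by
  intro m
  induction m with
  | zero => intro b _; simp
  | succ m ih =>
    intro b hb
    have step := card_cr_add_two_le_mul_of_le hU hρ (b := b + 2 * m) (hyp (b + 2 * m) (by omega))
    rw [show b + 2 * m + 2 = b + 2 * (m + 1) by ring] at step
    calc _ ≤ ρ * _ := step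
      _ ≤ ρ * (ρ ^ m * _) := mul_le_mul_of_nonneg_left (ih b hb) hρ
      _ = ρ ^ (m + 1) * _ := by rw [pow_succ]; ring

/-! ### §4 The two tails -/

/-- A single class is at most the whole set of perfect matchings. [folklore] -/
theorem card_cr_le_card {S U : Finset V} (b : ℕ) :
    ((perfectMatchings S).filter fun M => (M.filter fun e => cutCount U e = 1).card = b).card ≤
      (perfectMatchings S).card :=
  card_filter_le _ _

/-- `#{cr ≤ k+1} = #{cr ≤ k} + #{cr = k+1}`. [folklore] -/
theorem card_filter_cr_le_succ {S U : Finset V} (k : ℕ) :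
    ((perfectMatchings S).filter fun M => (M.filter fun e => cutCount U e = 1).card ≤ k + 1).card =
      ((perfectMatchings S).filter fun M => (M.filter fun e => cutCount U e = 1).card ≤ k).card +
        ((perfectMatchings S).filter fun M => (M.filter fun e => cutCount U e = 1).card = k + 1).card := by
  rw [← card_union_of_disjoint (disjoint_filter.2 fun M _ h1 h2 => by omega)]
  congr 1
  ext M
  simp only [mem_filter, mem_union]
  constructor
  · rintro ⟨hM, h⟩
    by_cases h' : (M.filter fun e => cutCount U e = 1).card ≤ k
    · exact Or.inl ⟨hM, h'⟩
    · exact Or.inr ⟨hM, by omega⟩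
  · rintro (⟨hM, h⟩ | ⟨hM, h⟩)
    · exact ⟨hM, by omega⟩
    · exact ⟨hM, by omega⟩

/-- **LOWER TAIL (few crossing edges).** If `(b+1)(b+2) ≤ ρ·(|U| − b)(|S ∖ U| − b)` for all `b < a₀ + 2m`, then
`#{M ∈ PM(S) : cr(U,M) ≤ a₀} ≤ (a₀ + 1)·ρ^m·#PM(S)`. (Each of the `a₀ + 1` classes climbs `m` double steps.)
[cite: Rothvoss2017, §2 (PDF p. 5)] [folklore] -/
theorem card_filter_cr_le_le {S U : Finset V} (hU : U ⊆ S) {ρ : ℝ} {a₀ m : ℕ}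
    (hyp : ∀ b : ℕ, b < a₀ + 2 * m →
      ((b : ℝ) + 1) * ((b : ℝ) + 2) ≤ ρ * (((U.card - b : ℕ) : ℝ) * (((S \ U).card - b : ℕ) : ℝ))) :
    ((((perfectMatchings S).filter fun M => (M.filter fun e => cutCount U e = 1).card ≤ a₀).card : ℕ) : ℝ) ≤
      ((a₀ : ℝ) + 1) * ρ ^ m * ((perfectMatchings S).card : ℝ) := by
  -- nonnegativity of `ρ ^ m`
  have hρm : 0 ≤ ρ ^ m := by
    rcases Nat.eq_zero_or_pos m with rfl | hm
    · simp
    · exact pow_nonneg (pos_of_lower_hyp (hyp 0 (by omega))).1.le m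
  -- every class `b ≤ a₀` is at most `ρ^m · #PM`
  have hclass : ∀ b : ℕ, b ≤ a₀ →
      ((((perfectMatchings S).filter fun M => (M.filter fun e => cutCount U e = 1).card = b).card : ℕ) : ℝ) ≤
        ρ ^ m * ((perfectMatchings S).card : ℝ) := by
    intro b hb
    have h := card_cr_le_pow_mul hU hyp m b (by omega)
    exact h.trans (mul_le_mul_of_nonneg_left (by exact_mod_cast card_cr_le_card (b + 2 * m)) hρm)
  -- induction on the cut-off
  suffices H : ∀ k : ℕ, k ≤ a₀ →
      ((((perfectMatchings S).filter fun M => (M.filter fun e => cutCount U e = 1).card ≤ k).card : ℕ) : ℝ) ≤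
        ((k : ℝ) + 1) * ρ ^ m * ((perfectMatchings S).card : ℝ) from H a₀ le_rfl
  intro k hk
  induction k with
  | zero =>
    have h0 : ((perfectMatchings S).filter fun M => (M.filter fun e => cutCount U e = 1).card ≤ 0) =
        ((perfectMatchings S).filter fun M => (M.filter fun e => cutCount U e = 1).card = 0) :=
      filter_congr fun M _ => by simp only [Nat.le_zero]
    rw [h0]
    have := hclass 0 (Nat.zero_le _)
    simpa using this
  | succ k ih =>
    have ih' := ih (by omega)
    rw [card_filter_cr_le_succ, Nat.cast_add]
    have hlast := hclass (k + 1) hk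
    have : ((k : ℝ) + 1) * ρ ^ m * ((perfectMatchings S).card : ℝ) + ρ ^ m * ((perfectMatchings S).card : ℝ) =
        (((k + 1 : ℕ) : ℝ) + 1) * ρ ^ m * ((perfectMatchings S).card : ℝ) := by
      push_cast; ring
    linarith

/-- The crossing count never exceeds `|U|`. [folklore] -/
theorem cr_le_card {S U : Finset V} (hU : U ⊆ S) {M : Finset (Sym2 V)} (hM : M ∈ perfectMatchings S) :
    (M.filter fun e => cutCount U e = 1).card ≤ U.card := by
  have h := card_eq_cr_add_two_mul_in (mem_perfectMatchings.1 hM) hU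
  omega

/-- **UPPER TAIL (few non-crossing edges).** If `0 ≤ ρ` and `(|U| − b)(|S ∖ U| − b) ≤ ρ·(b+1)(b+2)` for all `b ≥ L` with
`b + 2 ≤ |U|`, `b + 2 ≤ |S ∖ U|`, then `#{M ∈ PM(S) : L + 2m ≤ cr(U,M)} ≤ (|U| + 1)·ρ^m·#PM(S)`.
[cite: Rothvoss2017, §2 (PDF p. 5)] [folklore] -/
theorem card_filter_le_cr_le {S U : Finset V} (hU : U ⊆ S) {ρ : ℝ} (hρ : 0 ≤ ρ) {L m : ℕ}
    (hyp : ∀ b : ℕ, L ≤ b → b + 2 ≤ U.card → b + 2 ≤ (S \ U).card →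
      ((U.card - b : ℕ) : ℝ) * (((S \ U).card - b : ℕ) : ℝ) ≤ ρ * (((b : ℝ) + 1) * ((b : ℝ) + 2))) :
    ((((perfectMatchings S).filter fun M => L + 2 * m ≤ (M.filter fun e => cutCount U e = 1).card).card : ℕ) : ℝ) ≤
      ((U.card : ℝ) + 1) * ρ ^ m * ((perfectMatchings S).card : ℝ) := by
  set s := (perfectMatchings S).filter fun M => L + 2 * m ≤ (M.filter fun e => cutCount U e = 1).card with hs_def
  have hfib : s.card = ∑ b ∈ range (U.card + 1),
      (s.filter fun M => (M.filter fun e => cutCount U e = 1).card = b).card :=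
    card_eq_sum_card_fiberwise (by
      intro M hM
      rw [mem_coe, hs_def, mem_filter] at hM
      rw [mem_coe, mem_range]
      exact Nat.lt_succ_of_le (cr_le_card hU hM.1))
  rw [hfib]
  push_cast
  have hterm : ∀ b ∈ range (U.card + 1),
      (((s.filter fun M => (M.filter fun e => cutCount U e = 1).card = b).card : ℕ) : ℝ) ≤
        ρ ^ m * ((perfectMatchings S).card : ℝ) := by
    intro b _
    by_cases hb : L + 2 * m ≤ b
    · have hsub : (s.filter fun M => (M.filter fun e => cutCount U e = 1).card = b) ⊆
          ((perfectMatchings S).filter fun M =>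
            (M.filter fun e => cutCount U e = 1).card = (b - 2 * m) + 2 * m) := by
        intro M hM
        rw [hs_def, mem_filter, mem_filter] at hM
        rw [mem_filter]
        exact ⟨hM.1.1, by omega⟩
      calc (((s.filter fun M => (M.filter fun e => cutCount U e = 1).card = b).card : ℕ) : ℝ)
          ≤ ((((perfectMatchings S).filter fun M =>
              (M.filter fun e => cutCount U e = 1).card = (b - 2 * m) + 2 * m).card : ℕ) : ℝ) := by
            exact_mod_cast card_le_card hsub
        _ ≤ ρ ^ m * _ := card_cr_add_le_pow_mul hU hρ hyp m (b - 2 * m) (by omega)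
        _ ≤ ρ ^ m * ((perfectMatchings S).card : ℝ) :=
            mul_le_mul_of_nonneg_left (by exact_mod_cast card_cr_le_card (b - 2 * m)) (pow_nonneg hρ m)
    · have hempty : (s.filter fun M => (M.filter fun e => cutCount U e = 1).card = b) = ∅ := by
        rw [filter_eq_empty_iff]
        intro M hM h
        rw [hs_def, mem_filter] at hM
        omega
      rw [hempty, card_empty, Nat.cast_zero]
      positivity
  calc ∑ b ∈ range (U.card + 1), (((s.filter fun M => (M.filter fun e => cutCount U e = 1).card = b).card : ℕ) : ℝ)
      ≤ ∑ b ∈ range (U.card + 1), ρ ^ m * ((perfectMatchings S).card : ℝ) := sum_le_sum hterm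
    _ = ((U.card : ℝ) + 1) * ρ ^ m * ((perfectMatchings S).card : ℝ) := by
        rw [sum_const, card_range, nsmul_eq_mul]; push_cast; ring

end General

end Summit.PneNP.PneNP.Theorems.ChebyshevTracialDesignCrossingCountTails
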